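import Literature.NumberTheory.GaussSums.KummerSector

/-!
# Birth skeleton (BC3) for the split child `GaussCubePrimary` (X₂) of `ArgLeg` (stmt-QuantumAdvantage-14637)

`GaussCubePrimary`: for `p ≡ 1 (3)` prime, `g` a primitive root, `u = g^{(p-1)/3}`, and `π = a + bω` PRIMARY
(`a ≡ 2`, `b ≡ 0 (mod 3)`) of norm `p` dividing `u − ω` in `ℤ[ω]`: `g(χ_{p,g})³ = p·π`
[Ireland–Rosen 1990, Ch. 9 §4, Lemma 1 + Corollary].  Line: the tree already has `g³ = p·J(χ,χ)`
(`cubicGaussSum_pow_three`) and `J` primary (`jacobiSum_cubicMulChar_primary`); it remains to see `J = π`, in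
COORDINATES (no `ℤ[ω]` type): both `J = a' + b'ω` and `π` lie in the kernel of `ℤ[ω] → 𝔽_p, ω ↦ u`
(`stub_jacobi_kernel`: the power sum `Σ_x x^K (1-x)^K` vanishes mod `p`; `stub_pi_kernel`: norms), and a primary
element of norm `p` in that kernel is unique (`stub_primary_unique`: `π'·π̄ = p·ε`, `ε` a unit, primary ⇒ `ε = 1`).
Numerics: 146 pairs `(p, g)`, `p < 400`, both orientations, 0 failures (planner scratch/check_gausscube.py).
-/

set_option linter.dupNamespace false -- `QuantumAdvantage.QuantumAdvantage` is the D-0017 nested layout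

namespace Summit.QuantumAdvantage.QuantumAdvantage.Cruxes.ArgLeg.GaussCubePrimaryBirth

open Literature.NumberTheory.GaussSums

/-- The split child, verbatim (defeq to the route decl once installed). -/
def GaussCubePrimary : Prop :=
  ∀ (p g : ℕ) (a b c d : ℤ), p.Prime → p % 3 = 1 → IsPrimitiveRoot (g : ZMod p) (p - 1) → a % 3 = 2 → b % 3 = 0 → a * a - a * b + b * b = (p : ℤ) → (((g ^ ((p - 1) / 3) % p : ℕ) : ℂ) - Literature.NumberTheory.GaussSums.omega = ((a : ℂ) + (b : ℂ) * Literature.NumberTheory.GaussSums.omega) * ((c : ℂ) + (d : ℂ) * Literature.NumberTheory.GaussSums.omega)) → Literature.NumberTheory.GaussSums.cubicGaussSum p g ^ 3 = (p : ℂ) * ((a : ℂ) + (b : ℂ) * Literature.NumberTheory.GaussSums.omega)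

/-- STUB 1 (Ireland–Rosen Ch. 9 §4, proof of Lemma 1, in coordinates): the Jacobi sum `J(χ,χ) = a' + b'ω` of the
cubic character `χ = χ_{p,g}` is primary of norm `p` and lies in the kernel of `ω ↦ u = g^{(p-1)/3}`:
`a' + b'u ≡ 0 (mod p)` — because `J ≡ Σ_x x^K (1-x)^K ≡ 0 (mod p)`, `K = (p-1)/3`, all exponents `< p - 1`.
(Primary-ness and `J = a' + b'ω` are `jacobiSum_cubicMulChar_primary`; the norm follows from `|g|² = p`, `g³ = pJ`.) -/
theorem stub_jacobi_kernel (p g : ℕ) [Fact p.Prime] (h3 : p % 3 = 1) (hg : IsPrimitiveRoot (g : ZMod p) (p - 1)) :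
    ∃ a' b' : ℤ, jacobiSum (cubicMulChar h3 hg) (cubicMulChar h3 hg) = (a' : ℂ) + (b' : ℂ) * omega ∧
      a' % 3 = 2 ∧ b' % 3 = 0 ∧ a' * a' - a' * b' + b' * b' = (p : ℤ) ∧
      (a' : ZMod p) + (b' : ZMod p) * (g : ZMod p) ^ ((p - 1) / 3) = 0 := by
  sorry

/-- STUB 2 (the certificate prime lies in the same kernel): if `π = a + bω` has norm `p` and divides `u₀ − ω`
(`u₀ = g^K mod p` as a natural number) with cofactor `c + dω`, then `a + b·u ≡ 0 (mod p)` — apply `ω ↦ u`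
to `u₀ − ω = πγ` to get `φ(π)φ(γ) = 0` in `𝔽_p`, and `φ(γ) ≠ 0` since `p² ∤ N(u₀ − ω) = u₀² + u₀ + 1 < p²`. -/
theorem stub_pi_kernel (p g : ℕ) (a b c d : ℤ) [Fact p.Prime] (h3 : p % 3 = 1)
    (hg : IsPrimitiveRoot (g : ZMod p) (p - 1)) (hN : a * a - a * b + b * b = (p : ℤ))
    (hdiv : ((g ^ ((p - 1) / 3) % p : ℕ) : ℂ) - omega = ((a : ℂ) + (b : ℂ) * omega) * ((c : ℂ) + (d : ℂ) * omega)) :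
    (a : ZMod p) + (b : ZMod p) * (g : ZMod p) ^ ((p - 1) / 3) = 0 := by
  sorry

/-- STUB 3 (uniqueness of the primary generator, Ireland–Rosen Prop. 9.3.5 in coordinates): two PRIMARY elements
`a + bω`, `a' + b'ω` of norm `p` in the kernel of `ℤ[ω] → 𝔽_p`, `ω ↦ u` (`u² + u + 1 = 0`) coincide:
`(a' + b'ω)(a + bω̄) = p·ε` with `ε` a unit, so `a' + b'ω = ε(a + bω)`, and only `ε = 1` keeps it primary. -/
theorem stub_primary_unique (p : ℕ) [Fact p.Prime] (u : ZMod p) (hu : u ^ 2 + u + 1 = 0) (a b a' b' : ℤ)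
    (ha : a % 3 = 2) (hb : b % 3 = 0) (ha' : a' % 3 = 2) (hb' : b' % 3 = 0)
    (hN : a * a - a * b + b * b = (p : ℤ)) (hN' : a' * a' - a' * b' + b' * b' = (p : ℤ))
    (hk : (a : ZMod p) + (b : ZMod p) * u = 0) (hk' : (a' : ZMod p) + (b' : ZMod p) * u = 0) :
    a' = a ∧ b' = b := by
  sorry

/-- `u = g^{(p-1)/3}` is a primitive cube root of unity in `𝔽_p` (for `p ≡ 1 (3)` prime and `g` a primitive
root). [folklore] -/
theorem cubeRoot_eq (p g : ℕ) [hp : Fact p.Prime] (h3 : p % 3 = 1) (hg : IsPrimitiveRoot (g : ZMod p) (p - 1)) :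
    ((g : ZMod p) ^ ((p - 1) / 3)) ^ 2 + (g : ZMod p) ^ ((p - 1) / 3) + 1 = 0 := by
  have hp5 : 5 ≤ p := by
    by_contra h
    have h2 : p ≠ 2 := fun h2 => by simp [h2] at h3
    have h3' : p ≠ 3 := fun h3' => by simp [h3'] at h3
    interval_cases p <;> first | exact absurd hp.out (by decide) | omega
  have hK : (p - 1) / 3 * 3 = p - 1 := by omega
  have hK0 : 0 < (p - 1) / 3 := by omega
  have hKlt : (p - 1) / 3 < p - 1 := by omega
  have hu3 : ((g : ZMod p) ^ ((p - 1) / 3)) ^ 3 = 1 := by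
    rw [← pow_mul, hK]; exact hg.pow_eq_one
  have hu1 : (g : ZMod p) ^ ((p - 1) / 3) ≠ 1 := hg.pow_ne_one_of_pos_of_lt hK0.ne' hKlt
  have hfac : ((g : ZMod p) ^ ((p - 1) / 3) - 1) * (((g : ZMod p) ^ ((p - 1) / 3)) ^ 2 + (g : ZMod p) ^ ((p - 1) / 3) + 1) = 0 := by
    have : ((g : ZMod p) ^ ((p - 1) / 3) - 1) * (((g : ZMod p) ^ ((p - 1) / 3)) ^ 2 + (g : ZMod p) ^ ((p - 1) / 3) + 1)
        = ((g : ZMod p) ^ ((p - 1) / 3)) ^ 3 - 1 := by ring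
    rw [this, hu3, sub_self]
  exact (mul_eq_zero.mp hfac).resolve_left (sub_ne_zero.mpr hu1)

/-- COMPOSITION (kernel-checked, no sorry): the three stubs give `GaussCubePrimary`. -/
theorem GaussCubePrimary_of
    (h1 : ∀ (p g : ℕ) [Fact p.Prime] (h3 : p % 3 = 1) (hg : IsPrimitiveRoot (g : ZMod p) (p - 1)),
      ∃ a' b' : ℤ, jacobiSum (cubicMulChar h3 hg) (cubicMulChar h3 hg) = (a' : ℂ) + (b' : ℂ) * omega ∧
        a' % 3 = 2 ∧ b' % 3 = 0 ∧ a' * a' - a' * b' + b' * b' = (p : ℤ) ∧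
        (a' : ZMod p) + (b' : ZMod p) * (g : ZMod p) ^ ((p - 1) / 3) = 0)
    (h2 : ∀ (p g : ℕ) (a b c d : ℤ) [Fact p.Prime] (h3 : p % 3 = 1) (hg : IsPrimitiveRoot (g : ZMod p) (p - 1)),
      a * a - a * b + b * b = (p : ℤ) →
      (((g ^ ((p - 1) / 3) % p : ℕ) : ℂ) - omega = ((a : ℂ) + (b : ℂ) * omega) * ((c : ℂ) + (d : ℂ) * omega)) →
      (a : ZMod p) + (b : ZMod p) * (g : ZMod p) ^ ((p - 1) / 3) = 0)
    (h3' : ∀ (p : ℕ) [Fact p.Prime] (u : ZMod p), u ^ 2 + u + 1 = 0 → ∀ a b a' b' : ℤ,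
      a % 3 = 2 → b % 3 = 0 → a' % 3 = 2 → b' % 3 = 0 →
      a * a - a * b + b * b = (p : ℤ) → a' * a' - a' * b' + b' * b' = (p : ℤ) →
      (a : ZMod p) + (b : ZMod p) * u = 0 → (a' : ZMod p) + (b' : ZMod p) * u = 0 → a' = a ∧ b' = b) :
    GaussCubePrimary := by
  intro p g a b c d hp h3 hg ha hb hN hdiv
  haveI : Fact p.Prime := ⟨hp⟩
  obtain ⟨a', b', hJ, ha', hb', hN', hk'⟩ := h1 p g h3 hg
  have hk := h2 p g a b c d h3 hg hN hdiv
  obtain ⟨rfl, rfl⟩ := h3' p _ (cubeRoot_eq p g h3 hg) a b a' b' ha hb ha' hb' hN hN' hk hk'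
  rw [cubicGaussSum_pow_three h3 hg, hJ]

end Summit.QuantumAdvantage.QuantumAdvantage.Cruxes.ArgLeg.GaussCubePrimaryBirth
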